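/-
Copyright (c) 2026. All rights reserved.
Released under Apache 2.0 license as described in the file LICENSE.
-/
import Literature.NumberTheory.GaloisRepresentations.HOneRestrictionOntoInvariantsFinite
import Literature.NumberTheory.GaloisRepresentations.ProcyclicHOneProfiniteCoefficients
import HarnessLib

/-!
# The local index sequence `0 → H¹_ur(F, T) → H¹(F, T) → H¹(I_F, T)^{Fr} → 0` for a
# non-archimedean local field and PROFINITE coefficients `T`

Topic `NumberTheory/GaloisRepresentations`; namespace `Literature.NumberTheory.GaloisRepresentations`.
THEOREMS ONLY (no definition, no named fact).  The local-field specialisation (`G = Γ_F`,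
`N = I_F = absInertia F`, `φ` any arithmetic Frobenius lift, `IsFrobPow φ 1`) of the tree's
free-procyclic-quotient package (`HOneRestrictionOntoInvariants`, `HOneUnramifiedProcyclic`,
`ProcyclicHOneProfiniteCoefficients`; finite coefficients: `HOneRestrictionOntoInvariantsFinite`), for
a Hausdorff topological `Γ_F`-module `X` with jointly continuous action presented by an `ℕ`-tower of
FINITE discrete levels (`DiscreteTowerPresentation`; e.g. `T = T_p E`, `T = ℤ_p(1)`, any finitely
generated `ℤ_p`-representation):

* **`exists_resSubgroup_absInertia_eq_of_conjMap_eq_of_tower`**,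
  `exists_resSubgroup_absInertia_eq_iff_forall_conjMap_eq_of_tower` — every Frobenius-invariant class
  of `H¹(I_F, T)` is the restriction of a class of `H¹(F, T)`: **`H¹(F, T) ↠ H¹(I_F, T)^{Fr}`**;
* **`exists_vanishing_apply_eq_absInertia_of_tower`** — every `t ∈ T^{I_F}` is the value at `φ` of a
  continuous cocycle of `Γ_F` VANISHING on `I_F` (an unramified class);
* **`oneCocycleClass_eq_iff_of_vanishing_absInertia`** — two `I_F`-vanishing cocycles have the same
  class iff their values at `φ` differ by `(φ − 1)v`, `v ∈ T^{I_F}` (no tower needed);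
  with `exists_rep_vanishing_of_resSubgroup_eq_zero` these say
  **`H¹_ur(F, T) := ker(H¹(F, T) → H¹(I_F, T)) ≅ T^{I_F}/(Fr − 1)T^{I_F}`**.

Together: the exact sequence `0 → H¹(F^nr/F, T^{I_F}) → H¹(F, T) → H¹(I_F, T)^{Fr} → 0`
(Rubin, *Euler Systems*, Lemma 1.3.2 (i) / Prop. B.2.5; Büyükboduk, JNT 129 (2009) §2.1.2; `cd Ẑ = 1`)
with both ends computed — the E-FREE part of the LOCAL INDEX
`[H¹_f(F, T) : H¹_ur(F, T)] = #(W^{I_F}/W^{I_F}_div)^{Fr}` (Rubin, Lemma 1.3.5) that measures the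
Tamagawa defect of an Euler system at a bad place (Mazur–Rubin, *Kolyvagin systems*, Remark A.5;
Büyükboduk 2009, Thm. 3.1). What is NOT here: the `E`-specific order `#H¹(I_w, T_pE)^{Fr} = (c_w)_p`.
-/

noncomputable section

open CategoryTheory

universe u

namespace Literature.NumberTheory.GaloisRepresentations

open Literature.AnabelianGeometry.AbsoluteAnabelian Literature.GroupTheory
open _root_.Subgroup _root_.Topology
open Field IsNonarchimedeanLocalField
open scoped Pointwise

variable (F : Type u) [Field F] [ValuativeRel F] [TopologicalSpace F] [IsNonarchimedeanLocalField F]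
variable {R : Type u} [CommRing R] [TopologicalSpace R]
variable (X : TopRep.{u} R (absoluteGaloisGroup F)) [T2Space X]

/-- **`H¹(F, T) ↠ H¹(I_F, T)^{Fr}` for profinite `T`.** For a non-archimedean local field `F`, its
inertia group `I_F = absInertia F`, an arithmetic Frobenius lift `φ` (`IsFrobPow φ 1`) and a Hausdorff
topological `Γ_F`-module `X` with jointly continuous action presented by a finite-level
`DiscreteTowerPresentation`: every class of `H¹(I_F, X)` fixed by `φ` is the restriction of a class of
`H¹(F, X) = H¹(Γ_F, X)`. [cite: Rubin2000, Lemma 1.3.2] [cite: NeukirchSchmidtWingberg2008, (1.6.7)] -/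
theorem exists_resSubgroup_absInertia_eq_of_conjMap_eq_of_tower
    (hXc : Continuous fun p : absoluteGaloisGroup F × X => X.ρ p.1 p.2)
    (P : DiscreteTowerPresentation X) (hfin : ∀ i, Finite (P.obj i))
    {φ : absoluteGaloisGroup F} (hφ : IsFrobPow φ 1)
    (yc : continuousCohomology 1 (subgroupRep X (absInertia F)))
    (hinv : haveI : (absInertia F).Normal := absInertia_normal_holds F
      conjMap X (absInertia F) φ 1 yc = yc) :
    ∃ xc : continuousCohomology 1 X, resSubgroup X (absInertia F) 1 xc = yc := by
  haveI := absoluteGaloisGroup_compactSpace F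
  haveI : (absInertia F).Normal := absInertia_normal_holds F
  exact exists_resSubgroup_eq_of_conjMap_eq_of_tower X hXc P hfin (absInertia F)
    (isClosed_absInertia_holds F) (isFreeProcyclic_quotient_absInertia' F) φ
    (dense_zpowers_mk_absInertia_of_isFrobPow F hφ) yc hinv

/-- **`range (H¹(F, T) → H¹(I_F, T)) = H¹(I_F, T)^{Γ_F}` for profinite `T`**: a class of `H¹(I_F, X)`
is restricted from `Γ_F` iff it is `Γ_F`-invariant. [cite: Rubin2000, Lemma 1.3.2]
[cite: NeukirchSchmidtWingberg2008, (1.6.7)] -/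
theorem exists_resSubgroup_absInertia_eq_iff_forall_conjMap_eq_of_tower
    (hXc : Continuous fun p : absoluteGaloisGroup F × X => X.ρ p.1 p.2)
    (P : DiscreteTowerPresentation X) (hfin : ∀ i, Finite (P.obj i))
    (yc : continuousCohomology 1 (subgroupRep X (absInertia F))) :
    (∃ xc : continuousCohomology 1 X, resSubgroup X (absInertia F) 1 xc = yc) ↔
      ∀ g : absoluteGaloisGroup F, haveI : (absInertia F).Normal := absInertia_normal_holds F
        conjMap X (absInertia F) g 1 yc = yc := by
  haveI := absoluteGaloisGroup_compactSpace F
  haveI : (absInertia F).Normal := absInertia_normal_holds F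
  exact exists_resSubgroup_eq_iff_forall_conjMap_eq_of_tower X hXc P hfin (absInertia F)
    (isClosed_absInertia_holds F) (isFreeProcyclic_quotient_absInertia' F) yc

/-- **`H¹_ur(F, T) ↠ T^{I_F}/(Fr − 1)T^{I_F}` for profinite `T`**: every `t ∈ X^{I_F}` is the value at
the Frobenius lift `φ` of a continuous cocycle of `Γ_F` vanishing on `I_F` (whose class is killed by
restriction to `I_F`, `resSubgroup_oneCocycleClass_eq_zero_of_vanishing`).
[cite: SerreLocalFields1979, XIII §1 Prop. 1] [cite: Rubin2000, Lemma 1.3.2] -/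
theorem exists_vanishing_apply_eq_absInertia_of_tower
    (P : DiscreteTowerPresentation X) (hfin : ∀ i, Finite (P.obj i))
    {φ : absoluteGaloisGroup F} (hφ : IsFrobPow φ 1)
    {t : X} (ht : ∀ n : absInertia F, X.ρ (n : absoluteGaloisGroup F) t = t) :
    ∃ z : contOneCocycles X, (∀ n : absInertia F, z.1 n = 0) ∧ z.1 φ = t := by
  haveI := absoluteGaloisGroup_compactSpace F
  haveI : (absInertia F).Normal := absInertia_normal_holds F
  exact exists_vanishing_apply_eq_of_tower X P hfin (absInertia F) (isClosed_absInertia_holds F)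
    (isFreeProcyclic_quotient_absInertia' F) φ (dense_zpowers_mk_absInertia_of_isFrobPow F hφ) ht

omit [T2Space X] in
/-- `I_F · ⟨φ⟩` is dense in `Γ_F` for any arithmetic Frobenius lift `φ`.
[cite: NeukirchSchmidtWingberg2008, Thm. 7.5.3] -/
theorem dense_absInertia_mul_zpowers_of_isFrobPow {φ : absoluteGaloisGroup F} (hφ : IsFrobPow φ 1) :
    Dense ((absInertia F : Set (absoluteGaloisGroup F)) * (zpowers φ : Set (absoluteGaloisGroup F))) := by
  haveI := absoluteGaloisGroup_compactSpace F
  haveI : (absInertia F).Normal := absInertia_normal_holds F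
  exact dense_mul_zpowers_of_dense (absInertia F) φ (dense_zpowers_mk_absInertia_of_isFrobPow F hφ)

/-- **`H¹_ur(F, T) ↪ T^{I_F}/(Fr − 1)T^{I_F}`** (any Hausdorff `X` with jointly continuous action; no
tower needed): two `I_F`-vanishing continuous cocycles of `Γ_F` have the same class iff their values
at the Frobenius lift `φ` differ by `(φ − 1)v` for some `v ∈ X^{I_F}`.
[cite: SerreLocalFields1979, XIII §1 Prop. 1] [cite: Rubin2000, Lemma 1.3.2] -/
theorem oneCocycleClass_eq_iff_of_vanishing_absInertia
    (hXc : Continuous fun p : absoluteGaloisGroup F × X => X.ρ p.1 p.2)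
    {φ : absoluteGaloisGroup F} (hφ : IsFrobPow φ 1) (z z' : contOneCocycles X)
    (hz : ∀ n : absInertia F, z.1 n = 0) (hz' : ∀ n : absInertia F, z'.1 n = 0) :
    oneCocycleClass X z = oneCocycleClass X z' ↔
      ∃ v : X, (∀ n : absInertia F, X.ρ (n : absoluteGaloisGroup F) v = v) ∧
        z.1 φ - z'.1 φ = X.ρ φ v - v :=
  oneCocycleClass_eq_iff_of_vanishing X hXc (dense_absInertia_mul_zpowers_of_isFrobPow F hφ) z z' hz hz'

/-- In particular an `I_F`-vanishing cocycle has trivial class iff its value at `φ` lies in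
`(φ − 1)X^{I_F}`. [cite: SerreLocalFields1979, XIII §1 Prop. 1] -/
theorem oneCocycleClass_eq_zero_iff_of_vanishing_absInertia
    (hXc : Continuous fun p : absoluteGaloisGroup F × X => X.ρ p.1 p.2)
    {φ : absoluteGaloisGroup F} (hφ : IsFrobPow φ 1) (z : contOneCocycles X)
    (hz : ∀ n : absInertia F, z.1 n = 0) :
    oneCocycleClass X z = 0 ↔
      ∃ v : X, (∀ n : absInertia F, X.ρ (n : absoluteGaloisGroup F) v = v) ∧ z.1 φ = X.ρ φ v - v :=
  oneCocycleClass_eq_zero_iff_of_vanishing X hXc (dense_absInertia_mul_zpowers_of_isFrobPow F hφ) z hz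

omit [T2Space X] in
/-- **The unramified representatives**: a class of `H¹(F, X)` killed by restriction to `I_F` is
represented by an `I_F`-vanishing cocycle, whose values are then `I_F`-invariant (the tree's
`exists_rep_vanishing_of_resSubgroup_eq_zero` + `apply_mem_invariants_of_vanishing` at `N = I_F`).
[cite: SerreGaloisCohomology1997, I §2.6 (b)] -/
theorem exists_rep_vanishing_absInertia_of_resSubgroup_eq_zero
    (hXc : Continuous fun p : absoluteGaloisGroup F × X => X.ρ p.1 p.2)
    (c : continuousCohomology 1 X) (hc : resSubgroup X (absInertia F) 1 c = 0) :
    ∃ z : contOneCocycles X, oneCocycleClass X z = c ∧ (∀ n : absInertia F, z.1 n = 0) ∧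
      ∀ (g : absoluteGaloisGroup F) (n : absInertia F), X.ρ (n : absoluteGaloisGroup F) (z.1 g) = z.1 g := by
  haveI : (absInertia F).Normal := absInertia_normal_holds F
  obtain ⟨z, hzc, hz⟩ := exists_rep_vanishing_of_resSubgroup_eq_zero X hXc c hc
  exact ⟨z, hzc, hz, fun g n => apply_mem_invariants_of_vanishing X z hz g n⟩

end Literature.NumberTheory.GaloisRepresentations

end
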